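import Summits.PneNP.PneNP.Theorems.SliceTarget.Negative.WitnessShape
import Summits.PneNP.PneNP.Theorems.SingleThreshold.Negative.Locality

/-!
# `SliceTarget` (stmt-PneNP-2832) — negative-side lemmas IV: targets on the picked line `Sketch-ideator3-r1`
# (`Cruxes/SliceTarget/Lines/Sketch_ideator3_r1.lean`): the guards of stub T3, the shape of the open stub T7

* T3 `FibreCliqueLower` (`∀ k ≥ 4, FibreCliqueLowerWith k (3·)`): `not_fibreCliqueLowerWith_of_frequently` (one mechanism:
  a cap admitting `#F = m_k(n)` lets `F = supp x₀` make the fibre `{x₀}` with no clique off `F`), whence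
  `fibreCliqueLower_false_at_three` (the guard `4 ≤ k` is load-bearing: `m_3(n) ≤ 3n`), `fibreCliqueLower_false_uncapped`
  (the cap is load-bearing, every `k ≥ 2`), `fibreCliqueLowerWith_cap_lt` (any admissible cap has `B n < m_k(n)` eventually).
* T7 `ParitySliceHardFrom2` (OPEN; `∀ c ≥ 2, ∃ k ≥ 3, ∃ δ > (1/k!)², ParityLB c k δ`): not refuted; witness shape
  `not_parityLB_of_le` (`k ≥ c + 1`, modulo T5, which is landed as `Ideator3Line.stub_coincidenceTail2` and is taken here as a
  hypothesis — instantiate with it), `not_parityLB_of_factorial_inv_lt` (`δ ≤ 1/k!`); `parityLB_of_sliceLB`,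
  `parityFrom2_of_sliceTarget_large` — T7 ⟸ X(≥2) with witnesses `δ_X > (3/2)(1/k!)²` (T7 ⟹ X(≥2) is the line's
  `sliceLB_of_parity`): the open stub is the crux conjunct X(≥2) plus an error FLOOR.

Refuter seat cdisprove-stmt-PneNP-2832 (gen 1, cycle 2), 2026-08-16; vocabulary in `LoadBearing.lean` / `WitnessShape.lean`.
-/

set_option linter.dupNamespace false

namespace Summit.PneNP.PneNP.Theorems.SliceTarget.Negative

open Literature.Computability.Complexity Filter Finset Classical
open Summit.PneNP.PneNP.Theses.OneSlice (SliceTarget)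
open Summit.PneNP.PneNP.Theorems.ConstantBand.Negative (Edge thr Central central_thr slice errSet)
open Summit.PneNP.PneNP.Theorems.SliceACZero.Negative (mk sliceCard sliceCard_eq mk_le_choose cliqueFn_false exists_edge)
open Summit.PneNP.PneNP.Theorems.SingleThreshold.Negative (pc tendsto_pc exists_monotone_cliqueCircuit)

section Line

open Summit.PneNP.PneNP.Theorems.SliceACZero.Negative renaming supp → esupp, mem_supp → mem_esupp, card_supp → card_esupp,
  supp_injective → esupp_injective
open Summit.PneNP.PneNP.Theorems.SingleThreshold.Negative (zeroOn)

/-! ### T3 `FibreCliqueLower`: the guards `4 ≤ k` and `#F ≤ 3n` are load-bearing -/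

/-- T3's clause at clique size `k` with a cap `B n` on the slot set: `∃ α > 0`, eventually, on every central slice, every
fibre over every `F` with `#F ≤ B n` has an `α`-fraction of graphs with a `k`-clique avoiding `F`
(T3 = `∀ k ≥ 4, FibreCliqueLowerWith k (3·)`). [folklore] -/
def FibreCliqueLowerWith (k : ℕ) (B : ℕ → ℕ) : Prop :=
  ∃ α : ℝ, 0 < α ∧ ∀ᶠ n : ℕ in atTop, ∀ j : ℕ, Central k n j →
    ∀ F : Finset (Edge n), #F ≤ B n → ∀ ρ : Edge n → Bool,
      α * #((slice n j).filter fun x => ∀ e ∈ F, x e = ρ e) ≤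
        #((slice n j).filter fun x => (∀ e ∈ F, x e = ρ e) ∧ cliqueFn n k (zeroOn F x) = true)

/-- If `F` contains every on-edge of `x₀ ∈ slice_j`, the fibre of slice `j` over `F` through `x₀` is `{x₀}`. [folklore] -/
theorem fibre_eq_singleton {n j : ℕ} {x₀ : Edge n → Bool} (hx₀ : x₀ ∈ slice n j) {F : Finset (Edge n)}
    (hF : esupp x₀ ⊆ F) : ((slice n j).filter fun x => ∀ e ∈ F, x e = x₀ e) = {x₀} := by
  ext x
  simp only [mem_filter, mem_singleton]
  constructor
  · rintro ⟨hx, hagree⟩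
    have hj : edgeCount x = edgeCount x₀ := by
      rw [(mem_filter.1 hx).2, (mem_filter.1 hx₀).2]
    have hsub : esupp x₀ ⊆ esupp x := fun e he => by
      rw [mem_esupp] at he ⊢
      rw [hagree e (hF (mem_esupp.2 he))]
      exact he
    have heq : esupp x₀ = esupp x :=
      eq_of_subset_of_card_le hsub (by rw [card_esupp, card_esupp, hj])
    exact esupp_injective heq.symm
  · rintro rfl
    exact ⟨hx₀, fun e _ => rfl⟩

/-- … and `x₀ ∖ F` is the empty graph. [folklore] -/
theorem zeroOn_eq_false_of_supp_subset {n : ℕ} {x₀ : Edge n → Bool} {F : Finset (Edge n)} (hF : esupp x₀ ⊆ F) :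
    zeroOn F x₀ = fun _ => false := by
  funext e
  show (if e ∈ F then false else x₀ e) = false
  split_ifs with he
  · rfl
  · cases h : x₀ e with
    | false => rfl
    | true => exact absurd (hF (mem_esupp.2 h)) he

/-- So no graph of that fibre has a `k`-clique avoiding `F` (`k ≥ 2`). [folklore] -/
theorem fibre_good_eq_empty {n j k : ℕ} (hk : 2 ≤ k) {x₀ : Edge n → Bool} (hx₀ : x₀ ∈ slice n j)
    {F : Finset (Edge n)} (hF : esupp x₀ ⊆ F) :
    ((slice n j).filter fun x => (∀ e ∈ F, x e = x₀ e) ∧ cliqueFn n k (zeroOn F x) = true) = ∅ := by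
  refine filter_eq_empty_iff.2 fun x hx h => ?_
  obtain ⟨hagree, hcl⟩ := h
  have hmem : x ∈ (slice n j).filter fun x => ∀ e ∈ F, x e = x₀ e := mem_filter.2 ⟨hx, hagree⟩
  rw [fibre_eq_singleton hx₀ hF, mem_singleton] at hmem
  subst hmem
  rw [zeroOn_eq_false_of_supp_subset hF, cliqueFn_false hk] at hcl
  exact Bool.false_ne_true hcl

/-- **One mechanism for both guards**: if the cap admits `#F = m_k(n)` for infinitely many `n`, T3's clause at `k ≥ 2` is
FALSE — take a point `x₀` of the central slice `j = m_k(n)`, `F := esupp x₀` (`#F = j`), `ρ := x₀`: the fibre is `{x₀}` and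
none of it has a clique avoiding `F`, so `α·1 ≤ 0`. [folklore] -/
theorem not_fibreCliqueLowerWith_of_frequently {k : ℕ} (hk : 2 ≤ k) {B : ℕ → ℕ}
    (hB : ∃ᶠ n : ℕ in atTop, thr k n ≤ B n) : ¬ FibreCliqueLowerWith k B := by
  rintro ⟨α, hα, H⟩
  obtain ⟨n, hBn, hn, hn1⟩ := (hB.and_eventually (H.and (eventually_ge_atTop 1))).exists
  have hjN : thr k n ≤ n.choose 2 := mk_le_choose hn1 hk
  obtain ⟨x₀, hx₀⟩ : (slice n (thr k n)).Nonempty := by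
    rw [← card_pos, card_slice_eq_sliceCard, sliceCard_eq]
    exact Nat.choose_pos hjN
  have hF : #(esupp x₀) ≤ B n := by
    rw [card_esupp, (mem_filter.1 hx₀).2]
    exact hBn
  have h := hn (thr k n) (central_thr k n) (esupp x₀) hF x₀
  rw [fibre_eq_singleton hx₀ subset_rfl, fibre_good_eq_empty hk hx₀ subset_rfl, card_singleton, card_empty,
    Nat.cast_one, mul_one, Nat.cast_zero] at h
  linarith

/-- `m_3(n) ≤ 3n`: for triangles the central slice fits inside a slot set of size `3n`. [folklore] -/
theorem thr_three_le (n : ℕ) : thr 3 n ≤ 3 * n := by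
  rw [thr]
  refine Nat.floor_le_of_le ?_
  rcases Nat.eq_zero_or_pos n with rfl | hn
  · simp
  have hn0 : (0 : ℝ) < n := by exact_mod_cast hn
  rw [show (-(2 : ℝ) / (((3 : ℕ) : ℝ) - 1)) = -1 by norm_num, Real.rpow_neg_one, Nat.cast_choose_two]
  rw [div_mul_eq_mul_div, div_le_iff₀ (by norm_num : (0 : ℝ) < 2)]
  have h1 : ((n : ℝ) * ((n : ℝ) - 1)) * (n : ℝ)⁻¹ = (n : ℝ) - 1 := by field_simp
  rw [h1]
  push_cast
  linarith

/-- **T3 is FALSE at `k = 3`** (its guard `4 ≤ k` is load-bearing): `m_3(n) = ⌊(n-1)/2⌋ ≤ 3n`, so the cap admits the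
whole support of a central graph. [folklore] -/
theorem fibreCliqueLower_false_at_three : ¬ FibreCliqueLowerWith 3 (fun n => 3 * n) :=
  not_fibreCliqueLowerWith_of_frequently (by norm_num) (Eventually.of_forall thr_three_le).frequently

/-- **T3 is FALSE without the cap on `#F`** (every `k ≥ 2`; cap `C(n,2)` = no cap). [folklore] -/
theorem fibreCliqueLower_false_uncapped {k : ℕ} (hk : 2 ≤ k) : ¬ FibreCliqueLowerWith k (fun n => n.choose 2) :=
  not_fibreCliqueLowerWith_of_frequently hk
    ((eventually_ge_atTop 1).mono fun _ hn => mk_le_choose hn hk).frequently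

/-- Conversely the cap `3n` never admits `m_k(n)` for `k ≥ 4` (`m_k(n) ≥ n^{4/3}/2 - 1 > 3n` eventually), so this mechanism
does not touch T3 itself; recorded as the threshold any admissible cap must respect: a cap `B` with `B n ≥ m_k(n)` infinitely
often kills the clause. [folklore] -/
theorem fibreCliqueLowerWith_cap_lt {k : ℕ} (hk : 2 ≤ k) {B : ℕ → ℕ} (H : FibreCliqueLowerWith k B) :
    ∀ᶠ n : ℕ in atTop, B n < thr k n := by
  by_contra h
  rw [not_eventually] at h
  exact not_fibreCliqueLowerWith_of_frequently hk (h.mono fun n hn => not_lt.1 hn) H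

/-! ### T7 `ParitySliceHardFrom2` (open): witness shape and its exact relation to X(≥2) -/

/-- T7's inner clause at `(c, k, δ)`: eventually, on every central slice, every `{∧₂,∨₂}`-circuit that disagrees with the
PARITY of the `k`-clique count on at most `δ·#slice_j` graphs has more than `n^c` gates. [folklore] -/
def ParityLB (c k : ℕ) (δ : ℝ) : Prop :=
  ∀ᶠ n : ℕ in atTop, ∀ j : ℕ, Central k n j → ∀ C : Circuit (Edge n), C.IsOver monotoneBasis →
    (#((slice n j).filter fun x => C.eval x ≠ decide (¬ 2 ∣ cliqueCount n k x)) : ℝ) ≤ δ * #(slice n j) →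
      n ^ c < C.size

/-- Off the tail `{ω_k ≥ 2}` the clique indicator IS the parity of the clique count. [folklore] -/
theorem cliqueFn_eq_parity_of_lt_two {n k : ℕ} (x : Edge n → Bool) (h : cliqueCount n k x < 2) :
    cliqueFn n k x = decide (¬ 2 ∣ cliqueCount n k x) := by
  rcases Nat.lt_succ_iff_lt_or_eq.1 h with h1 | h1
  · have h0 : cliqueCount n k x = 0 := by omega
    rw [(cliqueCount_eq_zero_iff x).1 h0, h0]
    decide
  · rw [(cliqueCount_ne_zero_iff x).1 (by omega), h1]
    decide

/-- The parity-error set of the projection `x_{e₀}` lies in `{x_{e₀} = 1} ∪ {k-clique}` (an odd count is a positive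
count). [folklore] -/
theorem parityErr_input_subset {n k j : ℕ} (e₀ : Edge n) :
    ((slice n j).filter fun x => (Circuit.input e₀).eval x ≠ decide (¬ 2 ∣ cliqueCount n k x)) ⊆
      (slice n j).filter (fun x => x e₀ = true) ∪
        univ.filter (fun x : Edge n → Bool => edgeCount x = j ∧ cliqueFn n k x = true) := by
  intro x hx
  rw [mem_filter, Circuit.eval_input] at hx
  obtain ⟨hxs, hne⟩ := hx
  rw [mem_union, mem_filter, mem_filter]
  cases h0 : x e₀ with
  | true => exact Or.inl ⟨hxs, rfl⟩
  | false =>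
    refine Or.inr ⟨mem_univ _, (mem_filter.1 hxs).2, ?_⟩
    rw [h0] at hne
    have hodd : ¬ 2 ∣ cliqueCount n k x := by
      intro hdiv
      apply hne
      rw [decide_eq_false (not_not_intro hdiv)]
    exact (cliqueCount_ne_zero_iff x).1 fun h0' => hodd (by rw [h0']; exact dvd_zero 2)

/-- **T7's δ-ceiling** (every `c`, `k ≥ 2`): `δ > 1/k!` is impossible — `x_{e₀}` is `δ`-accurate for the parity too. [folklore] -/
theorem not_parityLB_of_factorial_inv_lt {c k : ℕ} {δ : ℝ} (hk : 2 ≤ k) (hδ : 1 / (k.factorial : ℝ) < δ) :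
    ¬ ParityLB c k δ := by
  intro H
  have hε : 0 < δ - 1 / k.factorial := sub_pos.2 hδ
  have hev : ∀ᶠ n : ℕ in atTop, pc n k < δ - 1 / k.factorial :=
    (tendsto_pc hk).eventually (gt_mem_nhds hε)
  obtain ⟨n, hn, hpn, hn2⟩ := (H.and (hev.and (eventually_ge_atTop 2))).exists
  obtain ⟨e₀⟩ := exists_edge hn2
  have hN : 0 < n.choose 2 := Nat.choose_pos hn2
  have hjT : (thr k n : ℝ) ≤ (n.choose 2 : ℕ) * (n : ℝ) ^ (-(2 : ℝ) / ((k : ℝ) - 1)) :=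
    Nat.floor_le (by positivity)
  have hjN : thr k n ≤ n.choose 2 := mk_le_choose (by omega) hk
  have hratio : (thr k n : ℝ) / n.choose 2 ≤ pc n k := by
    rw [div_le_iff₀ (by exact_mod_cast hN), pc, mul_comm]
    exact hjT
  have herr : (#((slice n (thr k n)).filter fun x =>
      (Circuit.input e₀).eval x ≠ decide (¬ 2 ∣ cliqueCount n k x)) : ℝ) ≤ δ * #(slice n (thr k n)) :=
    calc _ ≤ (#((slice n (thr k n)).filter (fun x => x e₀ = true) ∪
          univ.filter (fun x : Edge n → Bool => edgeCount x = thr k n ∧ cliqueFn n k x = true)) : ℝ) := by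
          exact_mod_cast card_le_card (parityErr_input_subset e₀)
      _ ≤ ((thr k n : ℝ) / n.choose 2 + 1 / k.factorial) * #(slice n (thr k n)) :=
          card_onEdge_union_clique_le hk hn2 e₀ hjN hjT
      _ ≤ δ * #(slice n (thr k n)) := mul_le_mul_of_nonneg_right (by linarith) (Nat.cast_nonneg _)
  have hlt := hn (thr k n) (central_thr k n) (Circuit.input e₀) (input_isOver e₀ _) herr
  rw [Circuit.size_input] at hlt
  exact Nat.not_lt_zero _ hlt

/-- The parity-error set of an EXACT clique detector lies in the tail `{ω_k ≥ 2}`. [folklore] -/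
theorem parityErr_exact_subset {n k j : ℕ} {C : Circuit (Edge n)} (hC : ∀ x, C.eval x = cliqueFn n k x) :
    ((slice n j).filter fun x => C.eval x ≠ decide (¬ 2 ∣ cliqueCount n k x)) ⊆
      (slice n j).filter fun x => 2 ≤ cliqueCount n k x := by
  intro x hx
  rw [mem_filter] at hx ⊢
  refine ⟨hx.1, not_lt.1 fun hlt => hx.2 ?_⟩
  rw [hC x]
  exact cliqueFn_eq_parity_of_lt_two x hlt

/-- **T7's witnesses have `k ≥ c + 1`** (modulo T5): for `3 ≤ k ≤ c` and ANY `δ > (1/k!)²` the clause `ParityLB c k δ`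
is FALSE — the exact DNF (`≤ n^k ≤ n^c` gates) errs on the parity only on `{ω_k ≥ 2}`, of density `≤ (1/k!)²/2 + ε`. [folklore] -/
theorem not_parityLB_of_le
    (hT5 : (∀ k : ℕ, 3 ≤ k → ∀ ε : ℝ, 0 < ε → ∀ᶠ n : ℕ in atTop, ∀ j : ℕ, Central k n j →
      (#((slice n j).filter fun x => 2 ≤ cliqueCount n k x) : ℝ) ≤
        ((1 / (k.factorial : ℝ)) ^ 2 / 2 + ε) * #(slice n j)))
    {c k : ℕ} {δ : ℝ} (hk : 3 ≤ k) (hkc : k ≤ c) (hδ : (1 / (k.factorial : ℝ)) ^ 2 < δ) : ¬ ParityLB c k δ := by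
  intro H
  have hε : 0 < δ - (1 / (k.factorial : ℝ)) ^ 2 := sub_pos.2 hδ
  obtain ⟨n, hn, h5, hnk⟩ := (H.and ((hT5 k hk _ hε).and (eventually_ge_atTop (k + 1)))).exists
  obtain ⟨C, hCB, hs, he⟩ := exists_monotone_cliqueCircuit (n := n) (k := k) (by omega) (by omega)
  have herr : (#((slice n (thr k n)).filter fun x => C.eval x ≠ decide (¬ 2 ∣ cliqueCount n k x)) : ℝ) ≤
      δ * #(slice n (thr k n)) :=
    calc _ ≤ (#((slice n (thr k n)).filter fun x => 2 ≤ cliqueCount n k x) : ℝ) := by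
          exact_mod_cast card_le_card (parityErr_exact_subset he)
      _ ≤ ((1 / (k.factorial : ℝ)) ^ 2 / 2 + (δ - (1 / (k.factorial : ℝ)) ^ 2)) * #(slice n (thr k n)) :=
          h5 (thr k n) (central_thr k n)
      _ ≤ δ * #(slice n (thr k n)) := by
          refine mul_le_mul_of_nonneg_right ?_ (Nat.cast_nonneg _)
          nlinarith [sq_nonneg (1 / (k.factorial : ℝ))]
  have hlt := hn (thr k n) (central_thr k n) C hCB herr
  have h1 : C.size ≤ n ^ k := hs.trans (dnfSize_le_pow hk)
  have h3 : n ^ k ≤ n ^ c := Nat.pow_le_pow_right (by omega) hkc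
  omega

/-- **X(c) with a larger δ gives T7's clause** (modulo T5): if `SliceLB c k δ_X` and `δ + (1/k!)²/2 < δ_X` then
`ParityLB c k δ` — a circuit `δ`-accurate for the parity is `(δ + (1/k!)²/2 + ε)`-accurate for `CLIQUE_k`, since the two
functions agree off `{ω_k ≥ 2}`. [folklore] -/
theorem parityLB_of_sliceLB
    (hT5 : (∀ k : ℕ, 3 ≤ k → ∀ ε : ℝ, 0 < ε → ∀ᶠ n : ℕ in atTop, ∀ j : ℕ, Central k n j →
      (#((slice n j).filter fun x => 2 ≤ cliqueCount n k x) : ℝ) ≤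
        ((1 / (k.factorial : ℝ)) ^ 2 / 2 + ε) * #(slice n j)))
    {c k : ℕ} {δ δX : ℝ} (hk : 3 ≤ k) (hgap : δ + (1 / (k.factorial : ℝ)) ^ 2 / 2 < δX) (H : SliceLB c k δX) :
    ParityLB c k δ := by
  have hε : 0 < δX - δ - (1 / (k.factorial : ℝ)) ^ 2 / 2 := by linarith
  filter_upwards [H, hT5 k hk _ hε] with n hn h5 j hj C hCB herr
  refine hn j hj C hCB ?_
  have hsub : errSet n k j C ⊆ ((slice n j).filter fun x => C.eval x ≠ decide (¬ 2 ∣ cliqueCount n k x)) ∪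
      (slice n j).filter fun x => 2 ≤ cliqueCount n k x := by
    intro x hx
    rw [errSet, mem_filter] at hx
    obtain ⟨-, hxj, hne⟩ := hx
    have hxs : x ∈ slice n j := mem_filter.2 ⟨mem_univ _, hxj⟩
    rw [mem_union, mem_filter, mem_filter]
    by_cases hlt : cliqueCount n k x < 2
    · left
      exact ⟨hxs, by rwa [← cliqueFn_eq_parity_of_lt_two x hlt]⟩
    · exact Or.inr ⟨hxs, not_lt.1 hlt⟩
  calc (#(errSet n k j C) : ℝ)
      ≤ #(((slice n j).filter fun x => C.eval x ≠ decide (¬ 2 ∣ cliqueCount n k x)) ∪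
          (slice n j).filter fun x => 2 ≤ cliqueCount n k x) := by exact_mod_cast card_le_card hsub
    _ ≤ (#((slice n j).filter fun x => C.eval x ≠ decide (¬ 2 ∣ cliqueCount n k x)) : ℝ) +
          #((slice n j).filter fun x => 2 ≤ cliqueCount n k x) := by exact_mod_cast card_union_le _ _
    _ ≤ δ * #(slice n j) + ((1 / (k.factorial : ℝ)) ^ 2 / 2 + (δX - δ - (1 / (k.factorial : ℝ)) ^ 2 / 2)) *
          #(slice n j) := add_le_add herr (h5 j hj)
    _ = δX * #(slice n j) := by ring

/-- **T7 ⟸ X(≥2) with witnesses `δ_X > (3/2)(1/k!)²`** (modulo T5). The converse T7 ⟹ X(≥2) (with `δ_X = (δ-(1/k!)²)/4`)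
is the line's `sliceLB_of_parity`; X alone, whose witness `δ_X` is only known to satisfy `δ_X ≤ 1/k!` (§2), is not seen to
give T7: the open stub is the crux conjunct strengthened by an error FLOOR. [folklore] -/
theorem parityFrom2_of_sliceTarget_large
    (hT5 : (∀ k : ℕ, 3 ≤ k → ∀ ε : ℝ, 0 < ε → ∀ᶠ n : ℕ in atTop, ∀ j : ℕ, Central k n j →
      (#((slice n j).filter fun x => 2 ≤ cliqueCount n k x) : ℝ) ≤
        ((1 / (k.factorial : ℝ)) ^ 2 / 2 + ε) * #(slice n j)))
    (h : ∀ c : ℕ, 2 ≤ c → ∃ k : ℕ, 3 ≤ k ∧ ∃ δX : ℝ, 3 / 2 * (1 / (k.factorial : ℝ)) ^ 2 < δX ∧ SliceLB c k δX) :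
    ∀ c : ℕ, 2 ≤ c → ∃ k : ℕ, 3 ≤ k ∧ ∃ δ : ℝ, (1 / (k.factorial : ℝ)) ^ 2 < δ ∧ ParityLB c k δ := by
  intro c hc
  obtain ⟨k, hk, δX, hδX, H⟩ := h c hc
  refine ⟨k, hk, ((1 / (k.factorial : ℝ)) ^ 2 / 2 + δX) / 2, by linarith, ?_⟩
  exact parityLB_of_sliceLB hT5 hk (by linarith) H

end Line

end Summit.PneNP.PneNP.Theorems.SliceTarget.Negative
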